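/-
Copyright (c) 2026 the pub-hodgecm-mathlib formalisation cell (harness21).  Prover seat hodgecm-mathlib-F0P2-p08 (g0) (L1; S2 (law) for desk K2Liu-p05 (g6)'s final assembly
`K2LiuArchSWSpanningStd`, PLAN step 6 `?law`): Track B «K2-LIT», hLiu418 = stmt-HodgeConjecture-24832, road `K2_Liu`, socket #42S, organ S2, road (γ).
-/
import Summits.HodgeConjecture.HodgeConjecture.Theorems.K2LiuArchSiegelCharacterTubeConsumer   -- ★ (T2) `apply_update_tube_mul`, `tube_eq_of_chart_formula`
import Summits.HodgeConjecture.HodgeConjecture.Theorems.K2LiuHermitianTubeFrameSign              -- ★ `exists_tubeFrame₄` (explicit Shimura letters, `T·Tinv = 1 = Tinv·T`)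
import HarnessLib

/-!
# Crux `HLiu418`, #42S organ S2, road (γ), letter (law) AT THE EXPLICIT SHIMURA FRAME: the one-place Siegel law read through a chart with the matrix formula
# `ι_w P = reindex e₂ e₂ (T_t⁻¹ · P · T_t)` (★ `K2LiuArchReadingChart.exists_readingChart`'s `hιM`)

Cell `hodgecm-mathlib`, crux item hLiu418 = `stmt-HodgeConjecture-24832`; squad K2 ∕ K2Liu (L1, LEAD F0P6-plan (g14)); prover F0P2-p08 (g0); S2 desk K2Liu-p05 (g6).
THEOREMS ONLY (no `def`, no instance, no notation, no named-fact hypothesis, no `sorry`); lane `--supports stmt-HodgeConjecture-24832 --as helper`.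

★ (T2) `K2LiuArchSiegelCharacterTubeConsumer.apply_update_tube_mul` is stated for an abstract frame `T = (D D; C −C)`, `Tinv·T = 1`, `D`, `C` invertible, and a chart `ιw` with
`τ(ιw P) = P`.  The final assembly (desk PLAN `K2/K2Liu-p05/g6/PLAN-final-assembly…` step 2∕6) holds instead ★ `exists_readingChart`'s MATRIX FORMULA
`↑(ι_w P) = reindex e₂ e₂ (Tinv_t · P · T_t)` with the EXPLICIT Shimura letters of `t_w k = Re σ_w(dV_{(e⁻¹k).1} dW_{(e⁻¹k).2})`:
`T_t = (D D; C₀ −C₀)`, `Tinv_t = (P₀ −P₁; P₀ P₁)`, `D = diag √(|t|∕2)`, `C₀ = diag(i (t∕|t|) √(|t|∕2))`, `P₀ = diag((√(|t|∕2))⁻¹∕2)`, `P₁ = diag(i (√(|t|∕2))⁻¹ (t∕|t|)∕2)`.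
This file discharges the frame bookkeeping once and for all for a GENERIC nowhere-zero `t : Fin n → ℝ` (★ `exists_tubeFrame₄` (x): `T_t·Tinv_t = 1 = Tinv_t·T_t`; ★ `isUnit_det_shimuraFrame`;
★ `tube_eq_of_chart_formula`):
* **`apply_update_tube_mul_shimura`** — for `χ′` of unitary archimedean type `(t′, 0)`, an arch Siegel section `A` of weight `(χ′, s′)`, a chart `ιw` with the matrix formula on `U(J)` and
  multiplicative on `U(J)`, frozen components `y`, `p, g ∈ U(J)` with `p₂₁ = 0`:
  `A(archPiEquivCM⁻¹ (y[w ↦ ιw (p g)])) = (conj z∕‖z‖)^{−t′ w} · ‖z‖^{2s′+n} · A(archPiEquivCM⁻¹ (y[w ↦ ιw g]))`, `z = det p₁₁` — the (lawv′) clause of ★ ED. 3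
  `archSWRegionSpanning_of_readings_on` with `k w = −t′ w` (`t′ = M₂ • t_χ` by ★ `HasUnitaryArchType.pow_zero_right`), up to `Fintype.card (Fin n) = n`.
[Shimura1997, §§6.5, 16.4]; [Kudla1994, §3]; [HarrisKudlaSweet1996, §1 (1.15)]; [BorelJacquet1979, §4.1].
HONEST LABEL.  Count-neutral helper: `HC_CM` is proved only modulo the 7 printed citations (2 remaining named inputs: hLiu418 = `stmt-HodgeConjecture-24832`,
h413 = `stmt-HodgeConjecture-24833`) until rung 0 closes; this file closes no socket.
-/

set_option autoImplicit false
set_option linter.dupNamespace false -- the mandated namespace repeats `HodgeConjecture.HodgeConjecture`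

noncomputable section

open scoped Classical Matrix ComplexConjugate
open Complex NumberField NumberField.InfinitePlace NumberField.mixedEmbedding IsDedekindDomain
open Literature.NumberTheory.Automorphic Literature.NumberTheory.Automorphic.UnitaryGroup
open Literature.NumberTheory.GaloisRepresentations
open Literature.NumberTheory.GelbartRogawski1991 Literature.NumberTheory.GelbartRogawski1991.GRConstruction
open Literature.NumberTheory.GelbartRogawski1991.UnitaryDualPair
open Literature.NumberTheory.K2Lit.SiegelDoubled
open Summit.HodgeConjecture.HodgeConjecture.Cruxes.HLiu418.K2LiuArchSWSpanningDefs (IsArchSiegelDeltaSection)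
open Summit.HodgeConjecture.HodgeConjecture.Cruxes.HLiu418.K2LiuArchSiegelCharacterTube (isUnit_det_shimuraFrame)
open Summit.HodgeConjecture.HodgeConjecture.Cruxes.HLiu418.K2LiuArchSiegelCharacterTubeConsumer (apply_update_tube_mul tube_eq_of_chart_formula)
open Summit.HodgeConjecture.HodgeConjecture.Cruxes.HLiu418.K2LiuHermitianTubeFrameSign (exists_tubeFrame₄)

namespace Summit.HodgeConjecture.HodgeConjecture.Cruxes.HLiu418.K2LiuArchSiegelCharacterTubeShimura

variable (L : Type) [Field L] [NumberField L] [IsCMField L]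
variable {N M n : ℕ} (e : Fin N × Fin M ≃ Fin n)
  (dV : Fin N → L) (hdV : ∀ i, IsCMField.complexConj L (dV i) = dV i)
  (dW : Fin M → L) (hdW : ∀ i, IsCMField.complexConj L (dW i) = dW i)
  (w : {w : InfinitePlace L // w.IsComplex})

/-- **(law) AT THE EXPLICIT SHIMURA FRAME (the `?law` of the final assembly).**  `t : Fin n → ℝ` nowhere zero (the place form `t_w`), `ιw` a chart with ★ `exists_readingChart`'s matrix
formula on `U(J)` (explicit letters `T_t`, `Tinv_t`) and multiplicative on `U(J)`; `χ′` of unitary archimedean type `(t′, 0)`; `A` an arch Siegel section of weight `(χ′, s′)`; `y` frozen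
components; `p, g ∈ U(J)`, `p₂₁ = 0`.  Then `A(archPiEquivCM⁻¹ (y[w ↦ ιw (p g)])) = (conj z∕‖z‖)^{−t′ w} · ‖z‖^{2s′+n} · A(archPiEquivCM⁻¹ (y[w ↦ ιw g]))`, `z = det p₁₁`.
[cite: Shimura1997, §16.4] [cite: Kudla1994, §3] [cite: HarrisKudlaSweet1996, §1 (1.15)] [cite: BorelJacquet1979, §4.1] -/
theorem apply_update_tube_mul_shimura (t : Fin n → ℝ) (ht0 : ∀ k, t k ≠ 0)
    (ιw : Matrix (Fin n ⊕ Fin n) (Fin n ⊕ Fin n) ℂ → archLocal L (n + n) (hermD L e dV hdV dW hdW) w)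
    (hιM : ∀ P : Matrix (Fin n ⊕ Fin n) (Fin n ⊕ Fin n) ℂ, Pᴴ * Matrix.J (Fin n) ℂ * P = Matrix.J (Fin n) ℂ →
      (((ιw P : archLocal L (n + n) (hermD L e dV hdV dW hdW) w) : GL (Fin (n + n)) ℂ) : Matrix (Fin (n + n)) (Fin (n + n)) ℂ) =
        Matrix.reindex (e₂ (n := n)) (e₂ (n := n))
          (Matrix.fromBlocks (Matrix.diagonal (fun k => (((Real.sqrt (|t k| / 2))⁻¹ / 2 : ℝ) : ℂ))) (-Matrix.diagonal (fun k => I * (((Real.sqrt (|t k| / 2))⁻¹ * (t k / |t k|) / 2 : ℝ) : ℂ)))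
              (Matrix.diagonal (fun k => (((Real.sqrt (|t k| / 2))⁻¹ / 2 : ℝ) : ℂ))) (Matrix.diagonal (fun k => I * (((Real.sqrt (|t k| / 2))⁻¹ * (t k / |t k|) / 2 : ℝ) : ℂ))) * P *
            Matrix.fromBlocks (Matrix.diagonal (fun k => (Real.sqrt (|t k| / 2) : ℂ))) (Matrix.diagonal (fun k => (Real.sqrt (|t k| / 2) : ℂ)))
              (Matrix.diagonal (fun k => I * (((t k / |t k|) * Real.sqrt (|t k| / 2) : ℝ) : ℂ))) (-Matrix.diagonal (fun k => I * (((t k / |t k|) * Real.sqrt (|t k| / 2) : ℝ) : ℂ)))))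
    (hιmul : ∀ P Q : Matrix (Fin n ⊕ Fin n) (Fin n ⊕ Fin n) ℂ, Pᴴ * Matrix.J (Fin n) ℂ * P = Matrix.J (Fin n) ℂ → Qᴴ * Matrix.J (Fin n) ℂ * Q = Matrix.J (Fin n) ℂ →
      ιw (P * Q) = ιw P * ιw Q)
    {χ' : HeckeCharacter L} {t' : InfinitePlace L → ℤ} (ht : χ'.HasUnitaryArchType t' 0) {s' : ℂ}
    {A : arch (Fp L) L (IsCMField.complexConj L) (n + n) (hermD L e dV hdV dW hdW) → ℂ} (hA : IsArchSiegelDeltaSection L e dV hdV dW hdW χ' s' A)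
    (y : ∀ w' : {w : InfinitePlace L // w.IsComplex}, archLocal L (n + n) (hermD L e dV hdV dW hdW) w')
    (p g : Matrix (Fin n ⊕ Fin n) (Fin n ⊕ Fin n) ℂ) (hp : pᴴ * Matrix.J (Fin n) ℂ * p = Matrix.J (Fin n) ℂ) (hp21 : p.toBlocks₂₁ = 0)
    (hg : gᴴ * Matrix.J (Fin n) ℂ * g = Matrix.J (Fin n) ℂ) :
    A ((archPiEquivCM (n + n) L (hermD L e dV hdV dW hdW)).symm (Function.update y w (ιw (p * g)))) =
      (fun z : ℂ => (conj z / ((‖z‖ : ℝ) : ℂ)) ^ (-(t' w.1))) p.toBlocks₁₁.det * (((‖p.toBlocks₁₁.det‖ : ℝ) : ℂ)) ^ (2 * s' + (n : ℂ)) *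
        A ((archPiEquivCM (n + n) L (hermD L e dV hdV dW hdW)).symm (Function.update y w (ιw g))) := by
  obtain ⟨T, Tinv, h1, h2, -, -, -, -, -, hT, hTinv⟩ := exists_tubeFrame₄ t ht0
  subst hT hTinv
  obtain ⟨hD, hC⟩ := isUnit_det_shimuraFrame t ht0
  exact apply_update_tube_mul L e dV hdV dW hdW w _ _ _ h2 hD hC ιw (fun P hP => tube_eq_of_chart_formula _ _ h1 (hιM P hP)) hιmul ht hA y p g hp hp21 hg

end Summit.HodgeConjecture.HodgeConjecture.Cruxes.HLiu418.K2LiuArchSiegelCharacterTubeShimura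

end
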